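import Literature.AnabelianGeometry.EtaleTheta.Discharge.Sec5AodotCharacteristicOfTemperoid
import Literature.AnabelianGeometry.EtaleTheta.BiKummerThm44SubModelConnectedBinj

/-!
# [EtTh] Thm. 4.4 for a SELF-EQUIVALENCE `Ψ : C ⥲ C` over the genuine base `B^temp(Π^tp_X)⁰` — the hypothesis package
# `Thm44Hyp S S` EXISTS for every `Ψ` (Prop. 5.1's pin) and Thm. 4.4 (i)(ii)(iii) follow, modulo {`hBinj`, `hnd`, `hshape`,
# `hc : IsTopCharacteristic X.Pi H_⊙`, T44-L15b}

S. Mochizuki, *The étale theta function and its Frobenioid-theoretic manifestations*, Publ. RIMS **45** (2009)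
[MochizukiEtTh2009], Thm. 4.4 p.319–320 (PDF pp.93–94); Prop. 5.1 p.323 (PDF p.97): «`C` and the self-equivalence
`Ψ : C ⥲ C` satisfy all of the hypotheses of … Theorem 4.4 [for "`C₁`", "`C₂`", "`Ψ : C₁ ⥲ C₂`"]»; §5 p.322–323 (PDF
pp.96–97): «this `A_⊚^bs` is "characteristic" … [cf. Propositions 2.4, 2.6]».

abc-iut cell, layer L2, ROW «hchar PRODUCER» (abc-iut-L2-lead gen 4 ROWS #14b R251; seat abc-iut-w4-d008 gen 5), FILE 2:
the KNIT of FILE 1 (`Sec5AodotCharacteristicOfTemperoid`, p442771: `hchar`, `hopen`, `h34` discharged ⇒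
`∃ hh : Thm44Hyp S S, hh.Ψ = Ψ`) with abc-iut-w5-d179's consolidated Theorem 4.4 at the genuine connected base
(`BiKummerThm44SubModelConnectedBinj`: (i) ∧ (ii) ∧ (iii) ∧ `N`-th roots ⇐ {`hBinj₁/₂`, T44-L15b} for a GIVEN `h :
Thm44Hyp S₁ S₂`) and abc-iut-w5-d013's `Sec4Thm44OfConnectedTemperoid` (T44-L09/L09c/L08 unconditional).  PROOF-ONLY.

* `BiKummerSetting.exists_thm44Hyp_self_of_hBinj` — for EVERY self-equivalence `Ψ` of the tempered Frobenioid `C`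
  over `B^temp(Π^tp_X)⁰` (tree vocabularies): `∃ hh : Thm44Hyp S S, hh.Ψ = Ψ` ⇐ {`hBinj` (Def. 3.3 (iii): pull-backs of
  `B₀^Λ` injective — gives `hBmon` by abc-iut-L2-t3's `isMonoidOn_ratFnFunctor` + [FrdII] Ex. 1.3 (i)), `hnd` (Thm. 4.4's
  own hypothesis "`Φ` non-dilating"), `hshape` ("`D = D₀[𝒟]`"), `hc : IsTopCharacteristic X.Pi H_⊙` ([EtTh] Prop. 2.4
  clause, a hypothesis BY NAME)};
* `BiKummerSetting.exists_thm44_self_mkOfConnectedTemperoid` — **the same `hh` SATISFIES Thm. 4.4 (i), T44-L09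
  (`HodotCompatible`), T44-L09c (`GaloisCompatible`), T44-L08 (`PreservesAmple`), T44-L03 (`PreservesFrobeniusStructure`),
  and — given T44-L15b `hh.PreservesNHSaturatedBsFld` — Thm. 4.4 (ii) (fraction-pairs, `ψ = Ψ^birat = psiModel`), (iii)
  (saturation) and the `N`-th-roots clause** (every input of the printed proof p.95 other than the four named binders is a
  theorem of the tree: [FrdI] Thm. 3.4/4.2/5.2, Cor. 4.10/5.7; [SemiAnbd] Prop. 3.2, Rmk. 3.1.5, Ex. 3.10; [FrdII] Ex. 1.3;
  [EtTh] Thm. 3.7, Rmk. 3.7.2).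
HONEST FRAMING: refereed pre-IUT material; implications for data so parametrised (the class `TemperedFrobenioid T₀
(ConnectedPart (BTemp X.Pi)) (treeCatVocab …)` is not shown inhabited for an actual curve here); nothing here bears on
[IUTchIII] Cor. 3.12 — no side taken; typed ≠ proved — here PROVED modulo the displayed binders.
-/

noncomputable section

namespace Literature.AnabelianGeometry.EtaleTheta

open CategoryTheory Opposite Function Literature.AlgebraicGeometry.Frobenioids Literature.AnabelianGeometry.SemiGraphs

namespace BiKummerSetting

universe u₀ v₀ w

variable {K : Type u₀} [Field K] (X : SemiGraphs.TemperedArithmeticGroup.{u₀} K) {D₀ : Type u₀} [Category.{v₀} D₀]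
  {T₀ : RealifiedDivisorMonoids (D₀ := D₀) treeMonoidVocab.{w}}
  {IsRational IsStrictlyRational : ((ConnectedPart (BTemp X.Pi))ᵒᵖ ⥤ CommMonCat.{w}) → Prop}
  (C : TemperedFrobenioid T₀ (ConnectedPart (BTemp X.Pi)) (treeCatVocab (ConnectedPart (BTemp X.Pi)) IsRational IsStrictlyRational))
  (hZ : C.monoidType = MonoidType.Z) (hP : ∀ A : (ConnectedPart (BTemp X.Pi))ᵒᵖ, IsPerfect (C.Φ.carrier A))
  (NH : Subgroup (Field.absoluteGaloisGroup K) → C.category → ℕ+ → Prop) (A₀ : C.category)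
  (hA₀ : PreFrobenioid.IsFrobeniusTrivial C.toElem A₀) (hA₀' : SemiGraphs.IsGaloisObj A₀.base.obj)

/-- `hBmon` («`B` is a monoid on `D`», Def. 3.6 (ii) datum) over `B^temp(Π^tp_X)⁰` from `hBinj` alone (abc-iut-L2-t3's
`TemperedFrobenioid.isMonoidOn_ratFnFunctor` with [FrdII] Ex. 1.3 (i) «`B^temp(Π)⁰` of FSM-type»).
[cite: MochizukiEtTh2009, Def 3.6 (ii) p.302 (PDF p.76)] -/
theorem isMonoidOn_ratFnFunctor_of_hBinj (hBinj : ∀ {Y Y' : D₀ᵒᵖ} (g : Y ⟶ Y'), Injective (T₀.BΛ.map g).hom) :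
    IsMonoidOn C.ratFnFunctor :=
  C.isMonoidOn_ratFnFunctor hBinj fun α hα =>
    (QuasiTemperoid.BTempConnected.connectedPart_isOfFSMType (G := X.Pi)).isIso_of_isFSM α hα

/-- **Prop. 5.1's pin «`C` and `Ψ` satisfy the hypotheses of Theorem 4.4» over the genuine base `B^temp(Π^tp_X)⁰`, for
EVERY self-equivalence `Ψ`**: abc-iut-L2-t3's `Thm44Hyp S S` with underlying `Ψ` EXISTS ⇐ {`hBinj`, `hnd`, `hshape`,
`hc : IsTopCharacteristic X.Pi H_⊙`} (FILE 1's `exists_thm44Hyp_mkOfConnectedTemperoid_of_isTopCharacteristic'` with `hBmon ⟸ hBinj`).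
[cite: MochizukiEtTh2009, Prop 5.1 p.323 (PDF p.97)] -/
theorem exists_thm44Hyp_self_of_hBinj (hBinj : ∀ {Y Y' : D₀ᵒᵖ} (g : Y ⟶ Y'), Injective (T₀.BΛ.map g).hom)
    (hnd : ∀ (A : (ConnectedPart (BTemp X.Pi))ᵒᵖ) (f : A ⟶ A), treeMonoidVocab.{w}.IsNonDilating (C.Φ.carrier A) (C.Φ.pull f))
    (hshape : C.base.Full ∧ C.base.Faithful ∧
      ∃ 𝒟 : D₀, ∀ Y : D₀, (∃ A : ConnectedPart (BTemp X.Pi), Nonempty (C.base.obj A ≅ Y)) ↔ Nonempty (Y ⟶ 𝒟))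
    (hc : IsTopCharacteristic X.Pi (mkOfConnectedTemperoid X C hZ hP NH A₀ hA₀ hA₀').Hodot)
    (Ψ : C.category ≌ C.category) :
    ∃ hh : Thm44Hyp (mkOfConnectedTemperoid X C hZ hP NH A₀ hA₀ hA₀') (mkOfConnectedTemperoid X C hZ hP NH A₀ hA₀ hA₀'),
      hh.Ψ = Ψ :=
  exists_thm44Hyp_mkOfConnectedTemperoid_of_isTopCharacteristic' X C hZ hP NH A₀ hA₀ hA₀'
    (isMonoidOn_ratFnFunctor_of_hBinj X C hBinj) hnd hshape hc Ψ

/-- **[EtTh] Theorem 4.4 for a SELF-EQUIVALENCE `Ψ : C ⥲ C` over the genuine connected base `B^temp(Π^tp_X)⁰`.**  For every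
`Ψ` there is a hypothesis package `hh : Thm44Hyp S S` with `hh.Ψ = Ψ` which satisfies: T44-L03 (`Ψ` preserves Frobenius
degrees / isometries / Frobenius-type / pull-backs), T44-L09 `HodotCompatible`, T44-L09c `GaloisCompatible`, T44-L08
`PreservesAmple`, **Thm. 4.4 (i)**, and — given T44-L15b `hh.PreservesNHSaturatedBsFld` and any proofs `hF₁ hF₂ h3` for the
ψ-slot `ψ = Ψ^birat = psiModel hF₁ hF₂ h3` (they exist: `C.isFrobenioid_of_structural hBinj _`, the T44-L03 conjunct) —
**Thm. 4.4 (ii) (fraction-pairs), (iii) (saturation) and the `N`-th-roots clause** with the model pull-backs.  Residual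
binders: {`hBinj` (Def. 3.3 (iii) datum), `hnd` ("`Φ` non-dilating", Thm. 4.4's hypothesis), `hshape` ("`D = D₀[𝒟]`"),
`hc : IsTopCharacteristic X.Pi H_⊙` ([EtTh] Prop. 2.4 clause), T44-L15b}.
[cite: MochizukiEtTh2009, Thm 4.4 p.319–320 (PDF pp.93–94); Prop 5.1 p.323 (PDF p.97)] -/
theorem exists_thm44_self_mkOfConnectedTemperoid (hBinj : ∀ {Y Y' : D₀ᵒᵖ} (g : Y ⟶ Y'), Injective (T₀.BΛ.map g).hom)
    (hnd : ∀ (A : (ConnectedPart (BTemp X.Pi))ᵒᵖ) (f : A ⟶ A), treeMonoidVocab.{w}.IsNonDilating (C.Φ.carrier A) (C.Φ.pull f))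
    (hshape : C.base.Full ∧ C.base.Faithful ∧
      ∃ 𝒟 : D₀, ∀ Y : D₀, (∃ A : ConnectedPart (BTemp X.Pi), Nonempty (C.base.obj A ≅ Y)) ↔ Nonempty (Y ⟶ 𝒟))
    (hc : IsTopCharacteristic X.Pi (mkOfConnectedTemperoid X C hZ hP NH A₀ hA₀ hA₀').Hodot)
    (Ψ : C.category ≌ C.category) :
    ∃ hh : Thm44Hyp (mkOfConnectedTemperoid X C hZ hP NH A₀ hA₀ hA₀') (mkOfConnectedTemperoid X C hZ hP NH A₀ hA₀ hA₀'),
      hh.Ψ = Ψ ∧ hh.PreservesFrobeniusStructure ∧ hh.HodotCompatible ∧ hh.GaloisCompatible ∧ hh.PreservesAmple ∧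
      Thm44_i hh ∧
      ∀ (hF₁ hF₂ : PreFrobenioid.IsFrobenioid C.toElem) (h3 : hh.PreservesFrobeniusStructure)
        (_ : hh.PreservesNHSaturatedBsFld),
        Thm44_ii hh (hh.psiModel hF₁ hF₂ h3) ∧ Thm44_iii hh (hh.psiModel hF₁ hF₂ h3) ∧
          hh.PreservesNthRoots (hh.psiModel hF₁ hF₂ h3) (fun φ f => C.pullFracModel φ f) (fun φ f => C.pullFracModel φ f) := by
  obtain ⟨hh, hΨ⟩ := exists_thm44Hyp_self_of_hBinj X C hZ hP NH A₀ hA₀ hA₀' hBinj hnd hshape hc Ψ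
  refine ⟨hh, hΨ, hh.preservesFrobeniusStructure_mkOfConnectedTemperoid_of_hBinj hBinj hBinj,
    hh.hodotCompatible_mkOfConnectedTemperoid _ _ _ _ _ _ _ _ _ _ _ _ _ _,
    hh.galoisCompatible_mkOfConnectedTemperoid _ _ _ _ _ _ _ _ _ _ _ _ _ _,
    hh.preservesAmple_mkOfConnectedTemperoid _ _ _ _ _ _ _ _ _ _ _ _ _ _,
    hh.thm44_i_mkOfConnectedTemperoid_of_hBinj hBinj hBinj, fun hF₁ hF₂ h3 h15 => ?_⟩
  exact (hh.thm44_mkOfConnectedTemperoid_of_hBinj hF₁ hF₂ h3 hBinj hBinj h15).2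

end BiKummerSetting

end Literature.AnabelianGeometry.EtaleTheta

end
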